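import Summits.Ventures.HSemireg.WedgeHankelRecurrenceInterlacingEqual
import Summits.Ventures.HSemireg.WedgeHankelRecurrencePositivePairIndex
import Summits.Ventures.HSemireg.WedgeHankelRecurrenceCauchyIndexMinors

/-!
# Venture HSemireg — THE POSITIVE-PAIR DICTIONARY OF GANTMACHER XV §§14–15 AS ONE `TFAE`: for a real `h` of degree `t + 1` with `lc h > 0` and `deg g ≤ t`, the following are equivalent —
# (1) `p = h(X²) + X·g(X²)` is a Hurwitz polynomial; (2) the half-size Bezoutians `B_{t+1}(h, Xg)`, `B_{t+1}(g, h)` are `≻ 0` (N189); (3) the Hankel forms `S`, `S^{(1)}` of the Markov parameters are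
# `≻ 0` (Thm 17); (4) all `D_p, D_p^{(1)} > 0` ((115)); (5) `h` has simple negative real roots with `g·h′ > 0` (Thm 13∕14 in derivative form); (6) the roots of `h` and `g` are simple, real, negative and
# INTERLACE (Def 3); (7) `(h, g)` is a Stieltjes fraction with `c₀ = 0` and positive `c_i, d_i` (Thm 15∕16); (8) `Ind g/h = t + 1` and `Ind ug/h = −(t + 1)` on some window (Thm 14 (94))

HONEST FRAMING. Part of the Lean index of the computation cell `pub-hsemireg` (seat p10 gen 40, Sunday typer «UNIFORM-IN-n»).
A `List.TFAE` over statements already in the tree (N189, N203, N232, N234, N236, N239, N233): no new mathematics, no variety, no cohomology theory, no sheaf, no Ext group and no semiregularity map;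
nothing here says that HC / HC_CM / HC_AV holds; no Literature fact (unproved `Prop`) is declared or used.  Custodian versions as in `WedgeHankelSiegelIdeal` (1/3).
SOURCE (cited): F. R. Gantmacher, *The Theory of Matrices* II, Ch. XV §14 (Def 3, Thms 13–16), §15 (Thm 17, (115)); see the individual leaves for the printed statements and page chunks.
DEDUP DISCLOSURE (`rg -i tfae Summits/Ventures/HSemireg`, 2026-09-02): N223 `routh_hurwitz_tfae` (Hurwitz ⟺ Hermite form ⟺ Hurwitz determinants ⟺ Routh ⟺ Liénard–Chipart …); this `TFAE` is the
positive-pair side and shares only item (1) with it.  The 1 name below: 0 hits tree-wide.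

WHAT IS IN THE TREE.  N189 `forall_re_neg_iff_posDef_bezoutian_and_of_even`; N232 `forall_re_neg_iff_posDef_hankelSq_markovSeq_of_even`, `forall_re_neg_iff_forall_det_hankelSq_markovSeq_pos_of_even`; N203
`forall_re_neg_iff_hermiteBiehler_of_even`; N239 `forall_re_neg_iff_interlacing`; N233 `exists_stieltjesPair_of_posDef`; N234 `forall_re_neg_iff_posDef_pair`, `forall_re_neg_iff_exists_stieltjesPair`;
N236 `forall_re_neg_iff_cauchyIndex`; N158 `exists_window_roots` (IMPORTED — a v1 restated it and was caught by the gate's `dedup.fqn-exists` at the dry-run); N162 `cauchyIndex_eq_of_roots_mem` (window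
independence).  Mathlib: `List.TFAE`, `tfae_have`, `tfae_finish`.
THIS FILE (namespace `Summit.Ventures.HSemireg.Wedge.HankelOuter` continued; CHAINED on N240 + N236, PLAIN on N158; 0 definitions):
* §988 **`positivePair_even_tfae`** (the eight-way equivalence, even degree `2t + 2`).
CAVEATS.  Even degree only (`deg g ≤ t`); the odd-degree items are N230 ∕ N232 ∕ N234 ∕ N236 ∕ N240 individually.  Nothing Ext-side.  New names only.
-/

open Module Polynomial
open scoped Matrix Polynomial

namespace Summit.Ventures.HSemireg.Wedge.HankelOuter

open Summit.Ventures.HSemireg.Wedge Summit.Ventures.HSemireg.Wedge.Hankel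
open Literature.LinearAlgebra.Matrix.Bezoutian (bezoutian)
open Literature.Algebra.Polynomial (cauchyIndex)

/-! ## §988. The eight-way positive-pair equivalence (even degree) -/

/-- **THE POSITIVE-PAIR DICTIONARY (even degree `2t + 2`): for `deg h = t + 1`, `lc h > 0`, `deg g ≤ t`, the following are equivalent: (1) `h(X²) + X·g(X²)` is Hurwitz; (2) `B_{t+1}(h, Xg) ≻ 0 ∧
B_{t+1}(g, h) ≻ 0`; (3) `H_t(s) ≻ 0 ∧ H_t(s∘succ) ≻ 0` for the Markov parameters `s`; (4) `det H_k(s) > 0 ∧ det H_k(s∘succ) > 0` for all `k ≤ t`; (5) `h` splits with simple negative roots at which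
`g·h′ > 0`; (6) interlacing simple real roots `u_0 < w_0 < ⋯ < w_{t−1} < u_t < 0` with `deg g = t`, `lc g > 0`; (7) `(h, g) = a·stieltjesPair (t+1) c d` with `a > 0`, `c₀ = 0`, `c_i, d_i > 0`;
(8) `Ind g/h = t + 1 ∧ Ind ug/h = −(t + 1)` on a window containing the roots of `h`.** [Gantmacher XV §§14–15: Def 3, Thms 13–17, (94), (115); this file, §988] -/
theorem positivePair_even_tfae (t : ℕ) {h g : ℝ[X]} (hh : h.natDegree = t + 1) (hlc : 0 < h.leadingCoeff) (hg : g.natDegree ≤ t) :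
    List.TFAE [
      ∀ z ∈ ((expand ℝ 2 h + Polynomial.X * expand ℝ 2 g).map (algebraMap ℝ ℂ)).roots, z.re < 0,
      (bezoutian (t + 1) h (Polynomial.X * g)).PosDef ∧ (bezoutian (t + 1) g h).PosDef,
      (hankelSq ℝ t (markovSeq ℝ h g)).PosDef ∧ (hankelSq ℝ t (fun k => markovSeq ℝ h g (k + 1))).PosDef,
      ∀ k ≤ t, 0 < (hankelSq ℝ k (markovSeq ℝ h g)).det ∧ 0 < (hankelSq ℝ k (fun j => markovSeq ℝ h g (j + 1))).det,
      h.Splits ∧ h.Separable ∧ ∀ x ∈ h.roots, x < 0 ∧ 0 < g.eval x * (derivative h).eval x,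
      ∃ (u : Fin (t + 1) → ℝ) (w : Fin t → ℝ), StrictMono u ∧ StrictMono w ∧ h.roots = Finset.univ.val.map u ∧ g.roots = Finset.univ.val.map w ∧ g.natDegree = t
          ∧ 0 < g.leadingCoeff ∧ (∀ j, u j.castSucc < w j ∧ w j < u j.succ) ∧ u (Fin.last t) < 0,
      ∃ c d : ℕ → ℝ, c 0 = 0 ∧ (∀ i, 1 ≤ i → i ≤ t + 1 → 0 < c i) ∧ (∀ i, i < t + 1 → 0 < d i)
          ∧ ∃ a : ℝ, 0 < a ∧ h = C a * (stieltjesPair ℝ (t + 1) c d).1 ∧ g = C a * (stieltjesPair ℝ (t + 1) c d).2,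
      ∃ lo hi : ℝ, (∀ x ∈ h.roots, lo < x ∧ x < hi) ∧ cauchyIndex h g lo hi = (t + 1 : ℕ) ∧ cauchyIndex h (Polynomial.X * g) lo hi = -((t + 1 : ℕ) : ℤ)] := by
  have hp : (expand ℝ 2 h + Polynomial.X * expand ℝ 2 g).natDegree = 2 * t + 2 := by rw [natDegree_even_add_odd_of_lt_left (by omega), hh]; ring
  have hg' : g.natDegree ≤ t + 1 := hg.trans (Nat.le_succ t)
  have hgt : g.coeff (t + 1) = 0 := coeff_eq_zero_of_natDegree_lt (Nat.lt_succ_of_le hg)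
  have hc0 : g.coeff (t + 1) / h.coeff (t + 1) = 0 := by rw [hgt, zero_div]
  tfae_have 1 ↔ 2 := forall_re_neg_iff_posDef_bezoutian_and_of_even t h g hp
  tfae_have 1 ↔ 3 := forall_re_neg_iff_posDef_hankelSq_markovSeq_of_even t hh hg
  tfae_have 1 ↔ 4 := forall_re_neg_iff_forall_det_hankelSq_markovSeq_pos_of_even t hh hg
  tfae_have 1 ↔ 5 := forall_re_neg_iff_hermiteBiehler_of_even t hh hg hlc
  tfae_have 1 ↔ 6 := forall_re_neg_iff_interlacing t hh hg hlc
  tfae_have 1 ↔ 7 := by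
    rw [forall_re_neg_iff_exists_stieltjesPair (t + 1) hh hlc hg']
    constructor
    · rintro ⟨c, d, -, hc, hd, a, ha, h1, h2⟩
      -- `c₀ = g_{t+1}/h_{t+1} = 0` is forced: compare the top coefficients
      obtain ⟨⟨hH, hHlc, -⟩, -, -⟩ := stieltjesPair_posDef (t + 1) c d hc hd
      have htop := coeff_stieltjesPair_snd (t + 1) c d hc hd
      have e2 := congrArg (fun q : ℝ[X] => q.coeff (t + 1)) h2
      simp only [coeff_C_mul] at e2
      rw [hgt, htop] at e2
      have hHm : (stieltjesPair ℝ (t + 1) c d).1.coeff (t + 1) ≠ 0 := by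
        have hne := leadingCoeff_ne_zero.2 (leadingCoeff_ne_zero.1 hHlc.ne'); rw [leadingCoeff, hH] at hne; exact hne
      have hc00 : c 0 = 0 := by
        have : a * (c 0 * (stieltjesPair ℝ (t + 1) c d).1.coeff (t + 1)) = 0 := e2.symm
        rcases mul_eq_zero.1 this with h0 | h0
        · exact absurd h0 ha.ne'
        · rcases mul_eq_zero.1 h0 with h0 | h0
          · exact h0
          · exact absurd h0 hHm
      exact ⟨c, d, hc00, hc, hd, a, ha, h1, h2⟩
    · rintro ⟨c, d, hc0', hc, hd, a, ha, h1, h2⟩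
      exact ⟨c, d, hc0'.symm.le, hc, hd, a, ha, h1, h2⟩
  tfae_have 1 ↔ 8 := by
    constructor
    · intro H
      obtain ⟨lo, hi, hw⟩ := exists_window_roots h
      obtain ⟨-, hi1, hi2⟩ := (forall_re_neg_iff_cauchyIndex (t + 1) hh hlc hg' hw).1 H
      exact ⟨lo, hi, hw, hi1, hi2⟩
    · rintro ⟨lo, hi, hw, hi1, hi2⟩
      exact (forall_re_neg_iff_cauchyIndex (t + 1) hh hlc hg' hw).2 ⟨hc0.symm.le, hi1, hi2⟩
  tfae_finish

end Summit.Ventures.HSemireg.Wedge.HankelOuter
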